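import Literature.MathematicalPhysics.QuantumLattice.PeierlsChessboardTorusBound
import Literature.Probability.LatticeModels.IsingPeierls
import HarnessLib

/-!
# Peierls' bound for the Ising model on the two-dimensional torus, uniformly in the volume

Topic `Probability/LatticeModels`. For the nearest-neighbour Ising model on the discrete torus
`(ℤ/Lℤ)²` (periodic boundary condition, coupling `K ≥ 0`, zero field; the tree's
`isingTorusMeasure 2 L K 0`) we prove the LOW-TEMPERATURE LONG-RANGE-ORDER bound

  `⟨σ_0 σ_x⟩_{𝕋_L;K} ≥ 1 - 512·19⁶·e^{-2K}`   for all `L ≥ 3` and all `x ∈ (ℤ/Lℤ)²`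

(`isingTorus_torusTwoPoint_ge_one_sub_exp`), i.e. a Peierls estimate that is UNIFORM IN THE VOLUME
AND IN THE DISTANCE, with absurd but explicit constants. This is the classical Peierls argument
(Peierls 1936; Griffiths 1964) in the periodic-box organisation of Fröhlich–Lieb 1978, §I.C
(Thm. 1.1 / Cor. 1.2: on the torus a configuration with `σ_m = +`, `σ_n = -` is assigned the
CONTOUR `∂A` of a separating set `A ∋ m`, `A ∌ n`, and the contours of given length are counted
uniformly in the volume), with two inputs already in the tree:

* the volume-uniform torus contour count `TorusContourCounting.sum_pow_card_cutKeys_le_geom`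
  (`Σ_A θ^{|∂A|} ≤ 4ρ/(1-ρ)²`, `ρ = 4·19⁶·θ < 1`) together with the separating set
  `PeierlsChessboardTorusBound.sepSet` of a configuration and its properties
  (`isSeparatingSet_sepSet`, `sepSet_compatible`; the contour as a set of EDGES has `|∂A|` elements,
  `card_image_cutBonds`);
* Griffiths' correlation-inequality substitute for the contour flip,
  `IsingPeierls.gksExpect_allMinus_le`: in a ferromagnetic GKS system the probability that all the
  bonds of a fixed set `F` are unsatisfied is `≤ ∏_F (1 - tanh K)` — here for the free / whole-graph
  measure (`isingMeasure_univ_free_real_allDisagree_le`), playing the role of Friedli–Velenik's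
  (3.37) `μ(γ ⊆ ∂σ) ≤ e^{-2β|γ|}` with the rate `θ = 1 - tanh K ≤ 2e^{-2K}`.

Chain of the proof (`IsingTorusPeierls.*`):
`{σ_m = +, σ_n = -} ⊆ ⋃_{A separating} {all bonds of ∂A unsatisfied}` (`plusMinus_subset_iUnion`);
union bound and Griffiths' bound give `μ(σ_m = +, σ_n = -) ≤ Σ_A θ^{|∂A|} ≤ 4ρ/(1-ρ)²`
(`real_plusMinus_le`); `⟨σ_0σ_x⟩ = 1 - 2μ(σ_0 ≠ σ_x) ≥ 1 - 16ρ/(1-ρ)²`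
(`isingTorus_torusTwoPoint_ge`), and `ρ ≤ 1/2 ⇒ 16ρ/(1-ρ)² ≤ 64ρ ≤ 512·19⁶e^{-2K}`, while for
`ρ > 1/2` the bound is below `-1 ≤ ⟨σ_0σ_x⟩`.

Use: the `d = 2` case of the finite-temperature deconfinement of `ℤ₂` lattice gauge theory
(`Z2FiniteTemperatureDeconfinementD2.lean`), where the one-layer model of the Polyakov loops is the
periodic planar Ising model and no infrared bound is available.

No named facts, no sorries. HONEST NOTE: a 2-dimensional classical result with non-optimal
constants (Peierls' rate is `e^{-2K·ℓ}` with `3^ℓ` contours; here `(1 - tanh K)^ℓ` with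
`4ℓ(4·19⁶)^ℓ`); nothing here bears on the Yang–Mills mass gap.

## References

* R. Peierls, Proc. Camb. Phil. Soc. **32** (1936) 477–481. [Peierls1936]
* J. Fröhlich, E. H. Lieb, Comm. Math. Phys. **60** (1978) 233–267, §I.C Definition 1, Thm. 1.1,
  Cor. 1.2, eqs. (1.30)–(1.33). [FrohlichLieb1978]
* S. Friedli, Y. Velenik, *Statistical Mechanics of Lattice Systems*, CUP 2017, §3.7.2,
  Lemma 3.36, eqs. (3.37), (3.40). [FriedliVelenik2017]
-/

noncomputable section

open MeasureTheory Finset Filter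
open Literature.MathematicalPhysics.QuantumLattice (sepSet cutBonds isSeparatingSet_sepSet
  sepSet_compatible mem_of_mem_cutBonds adj_of_mem_cutBonds card_cutBonds plusCluster_subset_sepSet
  self_mem_plusCluster mem_sepSet)

namespace Literature.Probability.LatticeModels

/-! ### Griffiths' bound on unsatisfied bonds for the whole-graph (free) measure -/

section AllDisagree

variable {V : Type*} [Fintype V] [DecidableEq V] (G : SimpleGraph V) [DecidableRel G.Adj]

/-- **Unsatisfied bonds are exponentially unlikely in the whole-graph Ising measure**: for a finite
graph `G`, `β, h ≥ 0` and a finite set `F` of edges of `G`,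
`μ^{free}_{V;β,h}(σ_xσ_y = -1 ∀ {x,y} ∈ F) ≤ (1 - tanh β)^{|F|}` — Griffiths' bound
`gksExpect_allMinus_le` read through the Ising/GKS dictionary (all couplings of the whole-graph
measure are `β ≥ 0`). The torus analogue of the tree's `isingMeasure_plus_real_allDisagree_le`.
[cite: FriedliVelenik2017, §3.7.2, Lemma 3.36 and eq. (3.37)] -/
theorem isingMeasure_univ_free_real_allDisagree_le {β h : ℝ} (hβ : 0 ≤ β) (hh : 0 ≤ h)
    {F : Finset (Sym2 V)} (hF : ∀ e ∈ F, e ∈ G.edgeSet) :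
    (isingMeasure G univ β h .free).real {σ | ∀ e ∈ F, bondSpin σ e = -1} ≤
      (1 - Real.tanh β) ^ F.card := by
  classical
  have hFin : ∀ e ∈ F, e ∈ edgesIn G univ := fun e he =>
    mem_edgesIn_iff.2 ⟨hF e he, fun x _ => mem_univ x⟩
  rw [← integral_indicator_one (measurableSet_allDisagree F)]
  have hmeas : Measurable ({σ : SpinConfig V | ∀ e ∈ F, bondSpin σ e = -1}.indicator
      (1 : SpinConfig V → ℝ)) :=
    measurable_one.indicator (measurableSet_allDisagree F)
  rw [integral_isingMeasure G univ β h .free hmeas]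
  set T : Finset (Sym2 V ⊕ V) := F.map ⟨Sum.inl, Sum.inl_injective⟩ with hT
  have hTs : T ⊆ isingIdx G univ := by
    intro i hi
    rw [hT, Finset.mem_map] at hi
    obtain ⟨e, he, rfl⟩ := hi
    change Sum.inl e ∈ isingIdx G univ
    simp only [isingIdx, Finset.inl_mem_disjSum]
    exact edgesIn_subset_edgesTouching _ (hFin e he)
  -- the interaction term of an edge is its bond variable (all endpoints lie in `univ`)
  have hsp : ∀ (τ : SpinConfig ↥(univ : Finset V)) {e : Sym2 V}, e ∈ F →
      spinProduct (isingSupp univ (.inl e)) τ = bondSpin (glue univ τ .free) e := by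
    intro τ e he
    induction e using Sym2.ind with
    | _ x y =>
      have hxy : x ≠ y := G.ne_of_adj ((SimpleGraph.mem_edgeSet G).1 (hF _ he))
      rw [spinProduct_isingSupp_inl τ .free hxy, if_pos (mem_univ x), if_pos (mem_univ y),
        bondSpin_mk]
  have hind : ∀ τ : SpinConfig ↥(univ : Finset V), {σ : SpinConfig V | ∀ e ∈ F, bondSpin σ e = -1}.indicator
      (1 : SpinConfig V → ℝ) (glue univ τ .free) = allMinus (isingSupp univ) T τ := by
    intro τ
    simp only [allMinus, hT, Finset.prod_map, Function.Embedding.coeFn_mk, Set.indicator_apply,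
      Set.mem_setOf_eq, Pi.one_apply]
    by_cases hall : ∀ e ∈ F, bondSpin (glue univ τ .free) e = -1
    · rw [if_pos hall]
      symm
      refine Finset.prod_eq_one fun e he => ?_
      exact if_pos ((hsp τ he).trans (hall e he))
    · rw [if_neg hall]
      have hall' := hall
      simp only [not_forall] at hall'
      obtain ⟨e, he, hne⟩ := hall'
      symm
      refine Finset.prod_eq_zero he ?_
      exact if_neg fun h' => hne ((hsp τ he).symm.trans h')
  have hsum : (∑ τ : ↥(univ : Finset V) → ℤˣ, isingWeight G univ β h .free τ *
      {σ : SpinConfig V | ∀ e ∈ F, bondSpin σ e = -1}.indicator 1 (glue univ τ .free)) /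
        isingPartitionFunction G univ β h .free =
      gksExpect (isingIdx G univ) (gksCoupling G univ β h .free) (isingSupp univ)
        (allMinus (isingSupp univ) T) := by
    rw [gksExpect, gksSum, gksSum, isingPartitionFunction]
    congr 1
    · refine Finset.sum_congr rfl fun τ _ => ?_
      rw [isingWeight_eq_gksWeight, hind, mul_comm]
    · refine Finset.sum_congr rfl fun τ _ => ?_
      rw [isingWeight_eq_gksWeight, one_mul]
  rw [hsum]
  refine (gksExpect_allMinus_le _ _ _ (gksCoupling_nonneg G hβ hh (Or.inl rfl)) T hTs).trans
    (le_of_eq ?_)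
  rw [hT, Finset.prod_map]
  simp only [Function.Embedding.coeFn_mk]
  rw [Finset.prod_congr rfl fun e he => by
    rw [gksCoupling_inl_of_mem_edgesIn G β h (Or.inl rfl) (hFin e he)], Finset.prod_const]

end AllDisagree

/-! ### The Peierls argument on the torus `(ℤ/Lℤ)²` -/

namespace IsingTorusPeierls

variable {L : ℕ} [NeZero L]

/-- Every cut edge `{i, j}` (`(i, j)` an ordered cut bond of `A`: `i ∈ A`, `j ∉ A`) is an edge of
the torus graph (`L ≥ 2`). [cite: FrohlichLieb1978, §I.C Definition 1] -/
theorem image_cutBonds_mem_edgeSet (hL : 1 < L) {A : Finset (TorusSite 2 L)} {e : Sym2 (TorusSite 2 L)}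
    (he : e ∈ (cutBonds A).image fun p => s(p.1, p.2)) : e ∈ (torusGraph 2 L).edgeSet := by
  obtain ⟨p, hp, rfl⟩ := mem_image.1 he
  exact (SimpleGraph.mem_edgeSet _).2 (adj_of_mem_cutBonds hL hp)

/-- The number of cut EDGES is the number of cut keys `|∂A|` (`L ≥ 3`): the ordered cut bonds
`(inside, outside)` give distinct unordered edges. [cite: FrohlichLieb1978, §I.C Definition 1] -/
theorem card_image_cutBonds (hL : 2 < L) (A : Finset (TorusSite 2 L)) :
    ((cutBonds A).image fun p => s(p.1, p.2)).card = (cutKeys L A).card := by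
  rw [← card_cutBonds hL A]
  refine card_image_of_injOn fun p hp q hq hpq => ?_
  have hp' := mem_of_mem_cutBonds (mem_coe.1 hp)
  have hq' := mem_of_mem_cutBonds (mem_coe.1 hq)
  rcases Sym2.eq_iff.1 hpq with ⟨h1, h2⟩ | ⟨h1, h2⟩
  · exact Prod.ext h1 h2
  · exact absurd (h1 ▸ hp'.1) hq'.2

/-- A unit of `ℤ` different from `1` is `-1`. [folklore] -/
private theorem units_eq_neg_one_of_ne_one {u : ℤˣ} (hu : u ≠ 1) : u = -1 := by
  rcases Int.units_eq_one_or u with h | h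
  · exact absurd h hu
  · exact h

open Classical in
/-- **The contour of a configuration** (Fröhlich–Lieb's Definition 1 on the torus): on the event
`σ_m = +, σ_n = -` the separating set `A(σ)` of the `+` cluster of `m` has ALL its boundary bonds
unsatisfied, so `{σ_m = +, σ_n = -} ⊆ ⋃_{A separating} {all bonds of ∂A unsatisfied}` (`L ≥ 2`).
[cite: FrohlichLieb1978, §I.C Definition 1 and (1.30)] -/
theorem plusMinus_subset_iUnion (hL : 1 < L) (m n : TorusSite 2 L) :
    {σ : SpinConfig (TorusSite 2 L) | σ m = 1 ∧ σ n = -1} ⊆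
      ⋃ A ∈ (univ.filter fun A => IsSeparatingSet L A m n),
        {σ | ∀ e ∈ (cutBonds A).image (fun p => s(p.1, p.2)), bondSpin σ e = -1} := by
  intro σ hσ
  obtain ⟨hm, hn⟩ := hσ
  set c : TorusSite 2 L → Bool := fun v => decide (σ v = 1) with hc
  have hcm : c m = true := by simp [hc, hm]
  have hcn : c n = false := by simp [hc, hn]
  refine Set.mem_iUnion₂.2 ⟨sepSet c m n, mem_filter.2 ⟨mem_univ _, isSeparatingSet_sepSet hL hcm hcn⟩, ?_⟩
  intro e he
  obtain ⟨p, hp, rfl⟩ := mem_image.1 he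
  obtain ⟨hu, hv⟩ := mem_of_mem_cutBonds hp
  obtain ⟨hcu, hcv⟩ := sepSet_compatible hcm hcn hu hv (adj_of_mem_cutBonds hL hp)
  have hσu : σ p.1 = 1 := by simpa [hc] using hcu
  have hσv : σ p.2 = -1 := units_eq_neg_one_of_ne_one (by simpa [hc] using hcv)
  rw [bondSpin_mk, spinAt, spinAt, hσu, hσv]
  norm_num

/-- **Peierls' estimate on the torus, volume-uniform**: for `L ≥ 3`, `K ≥ 0` and
`ρ = 4·19⁶·(1 - tanh K) < 1`,
`μ_{𝕋_L;K}(σ_m = +, σ_n = -) ≤ Σ_{A separating} (1 - tanh K)^{|∂A|} ≤ 4ρ/(1-ρ)²`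
(union bound over the contour of the configuration, Griffiths' bound for each contour, and the
Fröhlich–Lieb torus contour count). [cite: FrohlichLieb1978, Thm. 1.1 and Cor. 1.2, eqs. (1.30)–(1.33)]
[cite: FriedliVelenik2017, §3.7.2, eqs. (3.37)–(3.40)] -/
theorem real_plusMinus_le (hL : 2 < L) {K : ℝ} (hK : 0 ≤ K)
    (hρ : 4 * 19 ^ 6 * (1 - Real.tanh K) < 1) (m n : TorusSite 2 L) :
    (isingTorusMeasure 2 L K 0).real {σ | σ m = 1 ∧ σ n = -1} ≤
      4 * (4 * 19 ^ 6 * (1 - Real.tanh K)) / (1 - 4 * 19 ^ 6 * (1 - Real.tanh K)) ^ 2 := by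
  classical
  set θ : ℝ := 1 - Real.tanh K with hθ
  have hθ0 : 0 ≤ θ := by
    rw [hθ, sub_nonneg, Real.tanh_eq_sinh_div_cosh, div_le_one (Real.cosh_pos _)]
    exact (Real.sinh_lt_cosh _).le
  have hL1 : 1 < L := by omega
  set 𝒜 : Finset (Finset (TorusSite 2 L)) := univ.filter fun A => IsSeparatingSet L A m n with h𝒜
  calc (isingTorusMeasure 2 L K 0).real {σ | σ m = 1 ∧ σ n = -1}
      ≤ (isingTorusMeasure 2 L K 0).real
          (⋃ A ∈ 𝒜, {σ | ∀ e ∈ (cutBonds A).image (fun p => s(p.1, p.2)), bondSpin σ e = -1}) :=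
        measureReal_mono (plusMinus_subset_iUnion hL1 m n) (measure_ne_top _ _)
    _ ≤ ∑ A ∈ 𝒜, (isingTorusMeasure 2 L K 0).real
          {σ | ∀ e ∈ (cutBonds A).image (fun p => s(p.1, p.2)), bondSpin σ e = -1} :=
        measureReal_biUnion_finset_le _ _
    _ ≤ ∑ A ∈ 𝒜, θ ^ (cutKeys L A).card := by
        refine sum_le_sum fun A _ => ?_
        rw [← card_image_cutBonds hL A]
        exact isingMeasure_univ_free_real_allDisagree_le (torusGraph 2 L) hK le_rfl
          (fun e he => image_cutBonds_mem_edgeSet hL1 he)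
    _ ≤ 4 * (4 * 19 ^ 6 * θ) / (1 - 4 * 19 ^ 6 * θ) ^ 2 :=
        sum_pow_card_cutKeys_le_geom hL1 m n _ (fun A hA => (mem_filter.1 hA).2) hθ0 hρ

/-- `⟨σ_0 σ_x⟩ = 1 - 2 μ(σ_0 ≠ σ_x)` for a probability measure on spin configurations
(Friedli–Velenik (3.40) in two-point form). [cite: FriedliVelenik2017, §3.7.2, eq. (3.40)] -/
theorem torusTwoPoint_eq_one_sub (μ : Measure (SpinConfig (TorusSite 2 L))) [IsProbabilityMeasure μ]
    (x : TorusSite 2 L) :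
    torusTwoPoint μ x = 1 - 2 * μ.real {σ | σ 0 ≠ σ x} := by
  have hD : MeasurableSet {σ : SpinConfig (TorusSite 2 L) | σ 0 ≠ σ x} :=
    (Set.toFinite _).measurableSet
  have hpt : ∀ σ : SpinConfig (TorusSite 2 L), spinPair 0 x σ =
      1 - 2 * ({σ : SpinConfig (TorusSite 2 L) | σ 0 ≠ σ x}.indicator (fun _ => (1 : ℝ)) σ) := by
    intro σ
    simp only [spinPair, spinAt, Set.indicator_apply, Set.mem_setOf_eq]
    rcases Int.units_eq_one_or (σ 0) with h0 | h0 <;>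
      rcases Int.units_eq_one_or (σ x) with hx | hx <;> simp [h0, hx] <;> norm_num
  rw [torusTwoPoint, spinTwoPoint]
  simp_rw [hpt]
  rw [integral_sub (integrable_const _) ((Integrable.of_finite).const_mul _), integral_const,
    integral_const_mul]
  have hind : ∫ σ, {σ : SpinConfig (TorusSite 2 L) | σ 0 ≠ σ x}.indicator (fun _ => (1 : ℝ)) σ ∂μ =
      μ.real {σ | σ 0 ≠ σ x} := integral_indicator_one hD
  rw [hind]
  simp

omit [NeZero L] in
/-- `σ_0 ≠ σ_x` means `(σ_0, σ_x) = (+,-)` or `(σ_x, σ_0) = (+,-)`. [folklore] -/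
private theorem disagree_subset_union (x : TorusSite 2 L) :
    {σ : SpinConfig (TorusSite 2 L) | σ 0 ≠ σ x} ⊆
      {σ | σ 0 = 1 ∧ σ x = -1} ∪ {σ | σ x = 1 ∧ σ 0 = -1} := by
  intro σ hσ
  simp only [Set.mem_setOf_eq] at hσ
  rcases Int.units_eq_one_or (σ 0) with h0 | h0
  · left
    refine ⟨h0, units_eq_neg_one_of_ne_one fun hx => hσ (h0.trans hx.symm)⟩
  · right
    refine ⟨?_, h0⟩
    rcases Int.units_eq_one_or (σ x) with hx | hx
    · exact hx
    · exact absurd (h0.trans hx.symm) hσ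

end IsingTorusPeierls

open IsingTorusPeierls

section Main

variable {L : ℕ} [NeZero L]

/-- **Peierls' long-range-order bound for the periodic planar Ising model, uniformly in the
volume** (contour-series form): for `L ≥ 3`, `K ≥ 0` and `ρ = 4·19⁶·(1 - tanh K) < 1`,
`⟨σ_0 σ_x⟩_{𝕋_L;K} ≥ 1 - 16ρ/(1-ρ)²` for every `x ∈ (ℤ/Lℤ)²`.
[cite: FrohlichLieb1978, Thm. 1.1 and Cor. 1.2] [cite: Peierls1936] -/
theorem isingTorus_torusTwoPoint_ge (hL : 2 < L) {K : ℝ} (hK : 0 ≤ K)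
    (hρ : 4 * 19 ^ 6 * (1 - Real.tanh K) < 1) (x : TorusSite 2 L) :
    1 - 16 * (4 * 19 ^ 6 * (1 - Real.tanh K)) / (1 - 4 * 19 ^ 6 * (1 - Real.tanh K)) ^ 2 ≤
      torusTwoPoint (isingTorusMeasure 2 L K 0) x := by
  set μ := isingTorusMeasure 2 L K 0 with hμ
  set B : ℝ := 4 * (4 * 19 ^ 6 * (1 - Real.tanh K)) / (1 - 4 * 19 ^ 6 * (1 - Real.tanh K)) ^ 2
    with hB
  have h1 : μ.real {σ | σ 0 = 1 ∧ σ x = -1} ≤ B := real_plusMinus_le hL hK hρ 0 x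
  have h2 : μ.real {σ | σ x = 1 ∧ σ 0 = -1} ≤ B := real_plusMinus_le hL hK hρ x 0
  have hD : μ.real {σ | σ 0 ≠ σ x} ≤ 2 * B :=
    calc μ.real {σ | σ 0 ≠ σ x}
        ≤ μ.real ({σ | σ 0 = 1 ∧ σ x = -1} ∪ {σ | σ x = 1 ∧ σ 0 = -1}) :=
          measureReal_mono (disagree_subset_union x) (measure_ne_top _ _)
      _ ≤ μ.real {σ | σ 0 = 1 ∧ σ x = -1} + μ.real {σ | σ x = 1 ∧ σ 0 = -1} :=
          measureReal_union_le _ _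
      _ ≤ 2 * B := by linarith
  rw [torusTwoPoint_eq_one_sub μ x]
  have : 16 * (4 * 19 ^ 6 * (1 - Real.tanh K)) / (1 - 4 * 19 ^ 6 * (1 - Real.tanh K)) ^ 2 = 4 * B := by
    rw [hB]; ring
  rw [this]
  linarith

/-- `1 - tanh K ≤ 2 e^{-2K}`. [folklore] -/
private theorem one_sub_tanh_le_two_mul_exp (K : ℝ) : 1 - Real.tanh K ≤ 2 * Real.exp (-2 * K) := by
  rw [Real.tanh_eq]
  have hp : 0 < Real.exp K + Real.exp (-K) := by positivity
  have key : 1 - (Real.exp K - Real.exp (-K)) / (Real.exp K + Real.exp (-K)) =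
      2 * Real.exp (-K) / (Real.exp K + Real.exp (-K)) := by
    field_simp
    ring
  rw [key, div_le_iff₀ hp]
  have h2 : Real.exp (-2 * K) * Real.exp K = Real.exp (-K) := by
    rw [← Real.exp_add]; congr 1; ring
  nlinarith [Real.exp_pos K, Real.exp_pos (-K), Real.exp_pos (-2 * K), h2,
    mul_pos (Real.exp_pos (-2 * K)) (Real.exp_pos (-K))]

/-- **Peierls' long-range-order bound for the periodic planar Ising model, uniformly in the volume
and in the distance**: for every `K ≥ 0`, every `L ≥ 3` and every `x ∈ (ℤ/Lℤ)²`,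
`⟨σ_0 σ_x⟩_{𝕋_L;K} ≥ 1 - 512·19⁶·e^{-2K}`.
(For `8·19⁶(1 - tanh K) ≤ 1` this is `isingTorus_torusTwoPoint_ge` with `16ρ/(1-ρ)² ≤ 64ρ` and
`1 - tanh K ≤ 2e^{-2K}`; otherwise the left side is below `-1 ≤ ⟨σ_0σ_x⟩`.) [cite: Peierls1936] [cite: FrohlichLieb1978, Thm. 1.1 and Cor. 1.2]
[cite: FriedliVelenik2017, Thm. 3.25 (3) and §3.7.2] -/
theorem isingTorus_torusTwoPoint_ge_one_sub_exp (hL : 3 ≤ L) {K : ℝ} (hK : 0 ≤ K)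
    (x : TorusSite 2 L) :
    1 - 512 * 19 ^ 6 * Real.exp (-2 * K) ≤ torusTwoPoint (isingTorusMeasure 2 L K 0) x := by
  set θ : ℝ := 1 - Real.tanh K with hθ
  have hθ0 : 0 ≤ θ := by
    rw [hθ, sub_nonneg, Real.tanh_eq_sinh_div_cosh, div_le_one (Real.cosh_pos _)]
    exact (Real.sinh_lt_cosh _).le
  have hθe : θ ≤ 2 * Real.exp (-2 * K) := one_sub_tanh_le_two_mul_exp K
  by_cases hsmall : 8 * 19 ^ 6 * θ ≤ 1
  · set ρ : ℝ := 4 * 19 ^ 6 * θ with hρ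
    have hρ0 : 0 ≤ ρ := by positivity
    have hρhalf : ρ ≤ 1 / 2 := by rw [hρ]; linarith
    have hρ1 : ρ < 1 := by linarith
    have hmain := isingTorus_torusTwoPoint_ge (by omega) hK (by rw [← hθ]; exact hρ1) x
    rw [← hθ, ← hρ] at hmain
    -- `16ρ/(1-ρ)² ≤ 64ρ ≤ 512·19⁶ e^{-2K}`
    have hden : (1 / 4 : ℝ) ≤ (1 - ρ) ^ 2 := by nlinarith
    have hfrac : 16 * ρ / (1 - ρ) ^ 2 ≤ 64 * ρ := by
      rw [div_le_iff₀ (by positivity)]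
      nlinarith
    have h64 : 64 * ρ ≤ 512 * 19 ^ 6 * Real.exp (-2 * K) := by
      rw [hρ]; nlinarith [Real.exp_pos (-2 * K)]
    linarith
  · -- large `θ`: the bound is below `-1 ≤ ⟨σ_0σ_x⟩`
    push Not at hsmall
    have hneg : 1 - 512 * 19 ^ 6 * Real.exp (-2 * K) ≤ -1 := by nlinarith [Real.exp_pos (-2 * K)]
    have hge : -1 ≤ torusTwoPoint (isingTorusMeasure 2 L K 0) x := by
      rw [torusTwoPoint_eq_one_sub]
      have : (isingTorusMeasure 2 L K 0).real {σ : SpinConfig (TorusSite 2 L) | σ 0 ≠ σ x} ≤ 1 :=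
        measureReal_le_one
      linarith
    linarith

/-- **Long-range order of the periodic planar Ising model at low temperature** (`ε`-form): for
every `ε > 0` there is `K₀` such that `⟨σ_0 σ_x⟩_{𝕋_L;K} ≥ 1 - ε` for all `K ≥ K₀`, all `L ≥ 3`
and all `x` — Peierls' theorem in the periodic box, uniformly in the volume.
[cite: Peierls1936] [cite: FrohlichLieb1978, Thm. 1.1 and Cor. 1.2] -/
theorem isingTorus_longRangeOrder {ε : ℝ} (hε : 0 < ε) :
    ∃ K₀ : ℝ, 0 < K₀ ∧ ∀ (K : ℝ), K₀ ≤ K → ∀ (L : ℕ) [NeZero L], 3 ≤ L →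
      ∀ x : TorusSite 2 L, 1 - ε ≤ torusTwoPoint (isingTorusMeasure 2 L K 0) x := by
  -- choose `K₀` with `512·19⁶ e^{-2K₀} ≤ ε`
  obtain ⟨K₀, hK₀pos, hK₀⟩ : ∃ K₀ : ℝ, 0 < K₀ ∧ 512 * 19 ^ 6 * Real.exp (-2 * K₀) ≤ ε := by
    refine ⟨max 1 (Real.log (512 * 19 ^ 6 / ε) / 2), by positivity, ?_⟩
    have hle : Real.log (512 * 19 ^ 6 / ε) / 2 ≤ max 1 (Real.log (512 * 19 ^ 6 / ε) / 2) :=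
      le_max_right _ _
    have h1 : Real.exp (-2 * max 1 (Real.log (512 * 19 ^ 6 / ε) / 2)) ≤
        Real.exp (-Real.log (512 * 19 ^ 6 / ε)) := Real.exp_le_exp.2 (by linarith)
    rw [Real.exp_neg, Real.exp_log (by positivity), inv_div] at h1
    calc 512 * 19 ^ 6 * Real.exp (-2 * max 1 (Real.log (512 * 19 ^ 6 / ε) / 2))
        ≤ 512 * 19 ^ 6 * (ε / (512 * 19 ^ 6)) := by gcongr
      _ = ε := by field_simp
  refine ⟨K₀, hK₀pos, fun K hK L _ hL x => ?_⟩
  have hmono : Real.exp (-2 * K) ≤ Real.exp (-2 * K₀) := Real.exp_le_exp.2 (by linarith)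
  have h := isingTorus_torusTwoPoint_ge_one_sub_exp hL (hK₀pos.le.trans hK) x
  nlinarith

end Main

end Literature.Probability.LatticeModels

end
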